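import Mathlib
import Literature.NumberTheory.LFunctions.MoebiusCharacterSumsPowerfulModuli
import Summits.ValiantsHypothesis.ValiantsHypothesis.Theorems.LiouvilleSarnakAlignedTypeICharactersMod2nBilinearSieveLargeConductor
import Summits.ValiantsHypothesis.ValiantsHypothesis.Theorems.LiouvilleSarnakAlignedTypeICharactersMod2nBilinearSieveRanges
import Summits.ValiantsHypothesis.ValiantsHypothesis.Theorems.LiouvilleSarnakAlignedTypeICharactersMod2nBilinearSieveRange1
import HarnessLib

/-!
# Route LiouvilleSarnak — support `AlignedTypeI` (stmt-ValiantsHypothesis-21040), line `characters_mod_2n`: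
# the leaf from the CITED Banks–Shparlinski 2019 theorem (conditional result on one named Literature fact)

Final assembly of the bilinear-sieve chain.  From the named fact
`Literature.NumberTheory.LFunctions.BanksShparlinski2019_theorem22_twoPower_vonMangoldt` (Banks–Shparlinski, TAMS 373 (2020)
Thm 2.2, `ψ(x,χ) ≪ x E₂` for primitive `χ (mod 2^γ)`, `γ ≥ γ₀`, three ranges — NOT proved in the tree) we derive the
large-conductor hypothesis `H_Λ^large` of `alignedTypeI_of_largeConductorPrimeCharSums` (`largeConductorPrimeCharSums_of_BS`:
the three ranges are uniformly small in the leaf's regime `log t ≥ θ k log 2 ≥ θ log q`, by `bs_range1_small`, `bs_range2_small`,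
`bs_range3_small`), hence

  ★ `alignedTypeI_of_BanksShparlinski : BanksShparlinski2019_theorem22_twoPower_vonMangoldt → AlignedTypeI`.

Everything else on the path (bilinear Turán–Kubilius × large-sieve inequality, binary-rounding blocks, Mertens, Parseval,
partial summation, `ψ − θ ≤ 2√t log t`, primitive reduction, Siegel–Walfisz for small conductors) is PROVED in the tree.

HONEST FRAMING. CONDITIONAL RESULT: `AlignedTypeI` holds modulo the cited, unproved named fact (Banks–Shparlinski 2019 Thm 2.2,
von Mangoldt part, `q = 2^γ`).  This replaces the earlier conditional closure on Klurman–Mangerel–Teräväinen 2023 Thm 1.3.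
The leaf is NOT closed unconditionally; nothing here bears on `VP ≠ VNP` (NOT proved).
-/

set_option linter.dupNamespace false

noncomputable section

namespace Summit.ValiantsHypothesis.ValiantsHypothesis.Theorems.LiouvilleSarnak.AlignedTypeI.CharactersModTwoN

open Finset ArithmeticFunction
open scoped BigOperators

/-- **`H_Λ^large` from Banks–Shparlinski 2019 Thm 2.2** (the three ranges of `E₂` are uniformly `≤ η/C` in the regime
`log t ≥ θ k log 2`, `log q = j log 2 ≤ k log 2`, for `j ≥ J(θ, η)` and `k ≥ k₂(θ, η)`). [folklore] -/
theorem largeConductorPrimeCharSums_of_BS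
    (hBS : Literature.NumberTheory.LFunctions.BanksShparlinski2019_theorem22_twoPower_vonMangoldt) :
    ∀ th : ℝ, 0 < th → ∀ η : ℝ, 0 < η → ∃ J k₂ : ℕ, ∀ k : ℕ, k₂ ≤ k → ∀ j : ℕ, J ≤ j → j ≤ k →
      ∀ χ : DirichletCharacter ℂ (2 ^ j), χ.IsPrimitive → ∀ a : ℕ, th * k ≤ a → ∀ t : ℕ, 2 ^ a ≤ t →
        ‖∑ n ∈ Finset.Ioc 0 t, ((vonMangoldt n : ℝ) : ℂ) * χ (n : ZMod (2 ^ j))‖ ≤ η * t := by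
  obtain ⟨γ₀, c, hc, C, hB⟩ := hBS
  intro th hth η hη
  have hlog2 : 0 < Real.log 2 := Real.log_pos (by norm_num)
  -- a positive constant dominating `C`
  set C' : ℝ := max C 1 with hC'
  have hC'0 : 0 < C' := lt_of_lt_of_le one_pos (le_max_right _ _)
  have hCC' : C ≤ C' := le_max_left _ _
  set ε : ℝ := η / C' with hεdef
  have hε : 0 < ε := by positivity
  obtain ⟨L₁, hL₁⟩ := bs_range1_small hc hth hε
  obtain ⟨L₀, hL₀⟩ := bs_range2_small hc hε
  obtain ⟨U, hU⟩ := bs_range3_small hc hε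
  -- thresholds
  obtain ⟨J₁, hJ₁⟩ : ∃ J₁ : ℕ, max L₁ (max L₀ 3) / Real.log 2 ≤ J₁ := exists_nat_ge _
  obtain ⟨K, hK⟩ : ∃ K : ℕ, max U 1 / (th * Real.log 2) ≤ K := exists_nat_ge _
  refine ⟨max γ₀ J₁, K, fun k hk j hJj hjk χ hχ a ha t ht => ?_⟩
  have hγj : γ₀ ≤ j := le_trans (le_max_left _ _) hJj
  have hJ₁j : (J₁ : ℝ) ≤ j := by exact_mod_cast le_trans (le_max_right _ _) hJj
  -- `L = log (2^j) = j log 2 ≥ max L₁ L₀ 3`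
  set L : ℝ := Real.log ((2 : ℝ) ^ j) with hLdef
  have hLj : L = j * Real.log 2 := by rw [hLdef, Real.log_pow]
  have hLbig : max L₁ (max L₀ 3) ≤ L := by
    have h1 := (div_le_iff₀ hlog2).mp (hJ₁.trans hJ₁j)
    rw [hLj]; exact h1
  have hLL₁ : L₁ ≤ L := le_trans (le_max_left _ _) hLbig
  have hLL₀ : L₀ ≤ L := le_trans ((le_max_left _ _).trans (le_max_right _ _)) hLbig
  have hL3 : 3 ≤ L := le_trans ((le_max_right _ _).trans (le_max_right _ _)) hLbig
  have hL1 : 1 ≤ L := by linarith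
  have hL0 : 0 < L := by linarith
  -- `t ≥ 2^a`, `a ≥ th k ≥ th K ≥ ...`, so `u = log t ≥ a log 2 ≥ th k log 2 ≥ max U 1` and `≥ th L`
  have hthk : max U 1 ≤ th * k * Real.log 2 := by
    have h1 := (div_le_iff₀ (by positivity)).mp (hK.trans (show (K : ℝ) ≤ k by exact_mod_cast hk))
    linarith
  have ha1 : 1 ≤ a := by
    by_contra h0
    have : a = 0 := by omega
    rw [this, Nat.cast_zero] at ha
    have h1 : (1 : ℝ) ≤ th * k * Real.log 2 := le_trans (le_max_right _ _) hthk
    have h2 : th * k * Real.log 2 ≤ 0 := by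
      have := mul_nonpos_of_nonpos_of_nonneg (show th * k ≤ 0 from ha) hlog2.le
      linarith
    linarith
  have htR : (2 : ℝ) ^ a ≤ t := by exact_mod_cast ht
  have ht2 : (2 : ℝ) ≤ t := le_trans (by
    calc (2 : ℝ) = 2 ^ 1 := by norm_num
      _ ≤ 2 ^ a := pow_le_pow_right₀ (by norm_num) ha1) htR
  have ht0 : (0 : ℝ) < t := by linarith
  set u : ℝ := Real.log (t : ℝ) with hudef
  have hua : (a : ℝ) * Real.log 2 ≤ u := by
    have h1 : Real.log ((2 : ℝ) ^ a) ≤ u := Real.log_le_log (by positivity) htR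
    rwa [Real.log_pow] at h1
  have huk : th * k * Real.log 2 ≤ u := le_trans (mul_le_mul_of_nonneg_right ha hlog2.le) hua
  have huU : U ≤ u := le_trans (le_max_left _ _) (hthk.trans huk)
  have huL : th * L ≤ u := by
    have hjk' : (j : ℝ) ≤ k := by exact_mod_cast hjk
    calc th * L = th * (j * Real.log 2) := by rw [hLj]
      _ ≤ th * (k * Real.log 2) := by gcongr
      _ = th * k * Real.log 2 := by ring
      _ ≤ u := huk
  -- Banks–Shparlinski at `γ = j`, `x = t`
  have hmain := hB j hγj χ hχ (t : ℝ) ht2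
  rw [Nat.floor_natCast] at hmain
  refine hmain.trans ?_
  -- the saving is `≤ ε` in each range
  have hEsmall : (if (t : ℝ) ≤ Real.exp (L ^ (7 / 3 : ℝ) * Real.log L ^ (5 / 3 : ℝ))
        then Real.exp (-(c * u * L ^ (-(2 / 3 : ℝ)) * Real.log L ^ (-(4 / 3 : ℝ)))) * u ^ 2
      else if (t : ℝ) ≤ Real.exp (L ^ (7 : ℝ) * (Real.log L)⁻¹)
        then Real.exp (-(c * (u * L) ^ (1 / 2 : ℝ) * Real.log L ^ (-(1 / 2 : ℝ))))
      else Real.exp (-(c * u ^ (4 / 7 : ℝ) * Real.log u ^ (-(3 / 7 : ℝ))))) ≤ ε := by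
    split_ifs with h1 h2
    · -- first range: `u ≤ L^{7/3} (log L)^{5/3}`
      have hu1 : u ≤ L ^ (7 / 3 : ℝ) * Real.log L ^ (5 / 3 : ℝ) := by
        have := Real.log_le_log ht0 h1
        rwa [Real.log_exp] at this
      exact hL₁ L hLL₁ u huL hu1
    · -- second range: `u > L^{7/3} (log L)^{5/3} ≥ L`
      have hu2 : L ≤ u := by
        rw [not_le] at h1
        have h3 : L ^ (7 / 3 : ℝ) * Real.log L ^ (5 / 3 : ℝ) < u := by
          have := Real.log_lt_log (Real.exp_pos _) h1
          rwa [Real.log_exp] at this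
        have hlogL1 : 1 ≤ Real.log L := by
          rw [← Real.log_exp 1]
          refine Real.log_le_log (Real.exp_pos 1) (le_trans ?_ hL3)
          have := Real.exp_one_lt_d9
          linarith
        have h4 : L ≤ L ^ (7 / 3 : ℝ) := by
          calc L = L ^ (1 : ℝ) := (Real.rpow_one L).symm
            _ ≤ L ^ (7 / 3 : ℝ) := Real.rpow_le_rpow_of_exponent_le hL1 (by norm_num)
        have h5 : 1 ≤ Real.log L ^ (5 / 3 : ℝ) := Real.one_le_rpow hlogL1 (by norm_num)
        have h6 : L ≤ L ^ (7 / 3 : ℝ) * Real.log L ^ (5 / 3 : ℝ) := by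
          calc L = L * 1 := (mul_one L).symm
            _ ≤ L ^ (7 / 3 : ℝ) * Real.log L ^ (5 / 3 : ℝ) :=
                mul_le_mul h4 h5 zero_le_one (Real.rpow_nonneg hL0.le _)
        linarith
      exact hL₀ L hLL₀ u hu2
    · exact hU u huU
  have hEnn : 0 ≤ (if (t : ℝ) ≤ Real.exp (L ^ (7 / 3 : ℝ) * Real.log L ^ (5 / 3 : ℝ))
        then Real.exp (-(c * u * L ^ (-(2 / 3 : ℝ)) * Real.log L ^ (-(4 / 3 : ℝ)))) * u ^ 2
      else if (t : ℝ) ≤ Real.exp (L ^ (7 : ℝ) * (Real.log L)⁻¹)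
        then Real.exp (-(c * (u * L) ^ (1 / 2 : ℝ) * Real.log L ^ (-(1 / 2 : ℝ))))
      else Real.exp (-(c * u ^ (4 / 7 : ℝ) * Real.log u ^ (-(3 / 7 : ℝ))))) := by
    split_ifs <;> positivity
  calc C * (t : ℝ) * _ ≤ C' * (t : ℝ) * _ := by
        exact mul_le_mul_of_nonneg_right (mul_le_mul_of_nonneg_right hCC' ht0.le) hEnn
    _ ≤ C' * (t : ℝ) * ε := mul_le_mul_of_nonneg_left hEsmall (by positivity)
    _ = η * t := by rw [hεdef]; field_simp

/-- ★ **`AlignedTypeI` from the cited Banks–Shparlinski 2019 theorem** (CONDITIONAL RESULT on the named Literature fact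
`BanksShparlinski2019_theorem22_twoPower_vonMangoldt`; every other step proved in the tree). [folklore] -/
theorem alignedTypeI_of_BanksShparlinski
    (hBS : Literature.NumberTheory.LFunctions.BanksShparlinski2019_theorem22_twoPower_vonMangoldt) :
    Summit.ValiantsHypothesis.ValiantsHypothesis.Theses.LiouvilleSarnak.AlignedTypeI :=
  alignedTypeI_of_largeConductorPrimeCharSums (largeConductorPrimeCharSums_of_BS hBS)

end Summit.ValiantsHypothesis.ValiantsHypothesis.Theorems.LiouvilleSarnak.AlignedTypeI.CharactersModTwoN
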